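import Literature.MathematicalPhysics.QuantumLattice.ApproximatingHamiltonianProofs
import Literature.MathematicalPhysics.QuantumLattice.LiebFluxPhaseProofs
import HarnessLib

/-!
# Crux `CwThesis` (stmt-HubbardSuperconductivity-10438, route `ChiralWindow`), line
`SketchIdeator3` (penalty line, thermal form) — stub `stub_thermalPenaltyDescent`

**Thermal penalty descent** (the abstract finite-dimensional step C⁺⁺ → C⁺ of the line): for
Hermitian `H`, `Y` on a nonempty finite index type `m`, `β > 0` and real `κ`,

`κ · Re ω_{β, H+κY}(Y) - log |m| / β ≤ E₀(H + κY) - E₀(H)`,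

where `ω_{β,K} = Matrix.gibbsState β K` is the canonical Gibbs state, `Z = Matrix.partitionFn` and
`E₀ = Matrix.groundEnergy`.

Proof: Peierls–Bogoliubov in logarithmic form with base `K = H + κY` and perturbation `W = -κY`
(`log_partitionFn_sub_le_log_partitionFn_add`, linearity of the Gibbs state):
`log Z(K) + βκ Re ω_K(Y) ≤ log Z(H)`; then the entropy sandwich `-β E₀(K) ≤ log Z(K)`
(`exp_neg_mul_groundEnergy_le_partitionFn`) and `log Z(H) ≤ log |m| - β E₀(H)`
(`partitionFn_le_card_mul_exp`); combine and divide by `β`.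

No definition is introduced. [folklore]
-/

noncomputable section

set_option linter.dupNamespace false

namespace Summit.HubbardSuperconductivity.HubbardSuperconductivity.Theorems.CwThesis

open Matrix Literature.MathematicalPhysics.QuantumLattice
open scoped ComplexOrder

/-- **Thermal penalty descent.** For Hermitian `H`, `Y` on a nonempty finite index type `m`,
`β > 0` and real `κ`: `κ · Re ω_{β, H+κY}(Y) - log |m| / β ≤ E₀(H + κY) - E₀(H)`.
Peierls–Bogoliubov (logarithmic form) with base `H + κY` and perturbation `-κY`, plus the entropy
sandwich `e^{-βE₀} ≤ Re Z ≤ |m| e^{-βE₀}`, divided by `β`. [folklore] -/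
theorem stub_thermalPenaltyDescent {m : Type*} [Fintype m] [DecidableEq m] [Nonempty m]
    (H Y : Matrix m m ℂ) (hH : H.IsHermitian) (hY : Y.IsHermitian) {β : ℝ} (hβ : 0 < β) (κ : ℝ) :
    κ * (Matrix.gibbsState β (H + (κ : ℂ) • Y) Y).re - Real.log (Fintype.card m) / β ≤
      (H + (κ : ℂ) • Y).groundEnergy - H.groundEnergy := by
  -- hermiticity of the penalty `κY`, of the base `H + κY` and of the perturbation `-κY`
  have hκY : ((κ : ℂ) • Y).IsHermitian := IsHermitian.smul hY (Complex.conj_ofReal κ)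
  have hK : (H + (κ : ℂ) • Y).IsHermitian := hH.add hκY
  have hW : (-((κ : ℂ) • Y)).IsHermitian := hκY.neg
  -- Peierls–Bogoliubov: `log Z(K) - β Re ω_K(-κY) ≤ log Z(K + (-κY)) = log Z(H)`
  have hPB := log_partitionFn_sub_le_log_partitionFn_add hK hW β
  rw [add_neg_cancel_right, map_neg, map_smul, smul_eq_mul, Complex.neg_re,
    Complex.re_ofReal_mul] at hPB
  -- entropy sandwich: `-β E₀(K) ≤ log Z(K)` and `log Z(H) ≤ log |m| - β E₀(H)`
  have h1 := Real.log_le_log (Real.exp_pos _) (exp_neg_mul_groundEnergy_le_partitionFn hK β)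
  rw [Real.log_exp] at h1
  have hD : (0 : ℝ) < Fintype.card m := by exact_mod_cast Fintype.card_pos
  have h2 := Real.log_le_log (partitionFn_re_pos hH β) (partitionFn_le_card_mul_exp hH hβ.le)
  rw [Real.log_mul hD.ne' (Real.exp_pos _).ne', Real.log_exp] at h2
  -- combine and divide by `β`
  have key : κ * (Matrix.gibbsState β (H + (κ : ℂ) • Y) Y).re -
      ((H + (κ : ℂ) • Y).groundEnergy - H.groundEnergy) ≤ Real.log (Fintype.card m) / β := by
    rw [le_div_iff₀ hβ]
    linarith
  linarith

end Summit.HubbardSuperconductivity.HubbardSuperconductivity.Theorems.CwThesis
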